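import Summits.AtomisticToContinuum.Crystallization.Theorems.ExcessDecayLiouvilleTranslation
import Summits.AtomisticToContinuum.Crystallization.Theorems.ExcessDecayLiouvilleEquationBounds
import Summits.AtomisticToContinuum.Crystallization.Theorems.ExcessDecayLiouvilleLatticeSums

/-!
# Route `ExcessDecayLiouville`: translation-invariant lattice sums are constant on each sublattice

Bookkeeping for the harmonic-replacement architecture of item `ExcessDecay` (stmt-AtomisticToContinuum-9334).
A pair sum `p ↦ Σ'_{q ∈ S} Φ(p, q)` over the site set `S = Sites₀ t A` of an admissible datum whose kernel is
invariant under simultaneous lattice translation, `Φ(p + Aλ, q + Aλ) = Φ(p, q)` (`λ ∈ Λ₀`), takes the same value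
at all sites of one sublattice (`tsum_pair_sublattice_const`; pure reindexing by the site shift
`exists_sitesShift`, no summability needed).  Main instance: the force-constant operator applied to an AFFINE FIELD
`aff (t m + A z) = a m + B (t m + A z − c₀)` (two translations, one linear part) is a sublattice-wise constant
field (`affOpRow_sublattice_const`), with absolutely convergent rows (`summable_affOpRow`, terms
`≤ 38|p−q|⁻⁸(‖a 0 − a 1‖ + ‖B‖|p−q|)`, using the lattice sum `Σ |p−q|⁻⁷`, `summable_inv_pow_seven_sites`).
So subtracting an affine field from a displacement changes the linearised equation only by sublattice-wise
constants.  All `[folklore]`; helper lemmas, nothing here closes an item.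
-/

noncomputable section

namespace Summit.AtomisticToContinuum.Crystallization.Theorems.ExcessDecayLiouville

open scoped BigOperators Topology InnerProductSpace RealInnerProductSpace Classical
open Literature.MathematicalPhysics.StatisticalMechanics
open Summit.AtomisticToContinuum.Crystallization.Theorems.PhononStabilityNegative

-- Local notation: the force-constant map `K(e)w = h(|e|²)w + 2⟪e,w⟫h′(|e|²)e`.
local notation3 "𝕂[" e "] " w:max =>
  (-((‖e‖ ^ 2)⁻¹) ^ 7 + ((‖e‖ ^ 2)⁻¹) ^ 4) • w + (2 * ⟪e, w⟫ * (7 * ((‖e‖ ^ 2)⁻¹) ^ 8 - 4 * ((‖e‖ ^ 2)⁻¹) ^ 5)) • e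

section

variable {t : Fin 2 → (EuclideanSpace ℝ (Fin 3))} {A : (EuclideanSpace ℝ (Fin 3)) →L[ℝ] (EuclideanSpace ℝ (Fin 3))}

/-! ## Reindexing by the site shift -/

/-- **Lattice translations reindex site sums**: `Σ'_{q ∈ S} F(q + Aλ) = Σ'_{q ∈ S} F(q)` for `λ ∈ Λ₀`. [folklore] -/
theorem tsum_sites_translate {α : Type*} [AddCommMonoid α] [TopologicalSpace α]
    (F : (EuclideanSpace ℝ (Fin 3)) → α) {l : EuclideanSpace ℝ (Fin 3)} (hl : l ∈ Λ₀) :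
    ∑' q : Sites₀ t A, F ((q : EuclideanSpace ℝ (Fin 3)) + A l) = ∑' q : Sites₀ t A, F q := by
  obtain ⟨e, he⟩ := exists_sitesShift (t := t) (A := A) hl
  have : (fun q : Sites₀ t A => F ((q : EuclideanSpace ℝ (Fin 3)) + A l)) =
      fun q : Sites₀ t A => F ((e q : Sites₀ t A) : EuclideanSpace ℝ (Fin 3)) := by
    funext q; rw [he q]
  rw [this]
  exact Equiv.tsum_eq e (fun q : Sites₀ t A => F (q : EuclideanSpace ℝ (Fin 3)))

/-- **Translation-invariant pair sums are invariant**: if `Φ(p + Aλ, q + Aλ) = Φ(p, q)` for all sites `q`,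
then `Σ'_q Φ(p + Aλ, q) = Σ'_q Φ(p, q)`. [folklore] -/
theorem tsum_pair_translate {α : Type*} [AddCommMonoid α] [TopologicalSpace α]
    (Φ : (EuclideanSpace ℝ (Fin 3)) → (EuclideanSpace ℝ (Fin 3)) → α) (p : EuclideanSpace ℝ (Fin 3))
    {l : EuclideanSpace ℝ (Fin 3)} (hl : l ∈ Λ₀)
    (hΦ : ∀ q : Sites₀ t A, Φ (p + A l) ((q : EuclideanSpace ℝ (Fin 3)) + A l) = Φ p q) :
    ∑' q : Sites₀ t A, Φ (p + A l) q = ∑' q : Sites₀ t A, Φ p q := by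
  rw [← tsum_sites_translate (t := t) (A := A) (Φ (p + A l)) hl]
  exact tsum_congr hΦ

/-- **Sublattice-wise constancy**: a pair sum whose kernel is invariant under every simultaneous lattice
translation takes the same value at all sites `t m + A z` of the sublattice `m`. [folklore] -/
theorem tsum_pair_sublattice_const {α : Type*} [AddCommMonoid α] [TopologicalSpace α]
    (Φ : (EuclideanSpace ℝ (Fin 3)) → (EuclideanSpace ℝ (Fin 3)) → α)
    (hΦ : ∀ l ∈ Λ₀, ∀ p q : Sites₀ t A,
      Φ ((p : EuclideanSpace ℝ (Fin 3)) + A l) ((q : EuclideanSpace ℝ (Fin 3)) + A l) = Φ p q)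
    (m : Fin 2) {z z' : EuclideanSpace ℝ (Fin 3)} (hz : z ∈ Λ₀) (hz' : z' ∈ Λ₀) :
    ∑' q : Sites₀ t A, Φ (t m + A z') q = ∑' q : Sites₀ t A, Φ (t m + A z) q := by
  have hl : z' - z ∈ Λ₀ := hcpLiouvilleLam_sub_mem hz' hz
  have hp : t m + A z ∈ Sites₀ t A := ⟨m, z, hz, rfl⟩
  have heq : t m + A z' = (t m + A z) + A (z' - z) := by rw [map_sub]; abel
  rw [heq]
  exact tsum_pair_translate Φ (t m + A z) hl (fun q => hΦ _ hl ⟨_, hp⟩ q)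

/-! ## The lattice sum `Σ |p−q|⁻⁷` -/

/-- `q ↦ [q ≠ p] |q − p|⁻⁷` is summable over the sites for a site `p`, with sum `≤ 1024/((23/25)³(23/25)⁴)`.
[folklore] -/
theorem summable_inv_pow_seven_sites (hA : Adm₀ A) (hI : Inner₀ t A) {p : (EuclideanSpace ℝ (Fin 3))} (hp : p ∈ Sites₀ t A) :
    Summable (fun q : Sites₀ t A => if (q : (EuclideanSpace ℝ (Fin 3))) ≠ p then (dist (q : (EuclideanSpace ℝ (Fin 3))) p)⁻¹ ^ 7 else 0) ∧
    ∑' q : Sites₀ t A, (if (q : (EuclideanSpace ℝ (Fin 3))) ≠ p then (dist (q : (EuclideanSpace ℝ (Fin 3))) p)⁻¹ ^ 7 else 0) ≤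
      1024 / ((23 / 25 : ℝ) ^ 3 * (23 / 25 : ℝ) ^ 4) := by
  classical
  have hbound : ∀ u : Finset (Sites₀ t A),
      ∑ q ∈ u, (if (q : (EuclideanSpace ℝ (Fin 3))) ≠ p then (dist (q : (EuclideanSpace ℝ (Fin 3))) p)⁻¹ ^ 7 else 0) ≤
        1024 / ((23 / 25 : ℝ) ^ 3 * (23 / 25 : ℝ) ^ 4) := by
    intro u
    have hsum : ∑ q ∈ u, (if (q : (EuclideanSpace ℝ (Fin 3))) ≠ p then (dist (q : (EuclideanSpace ℝ (Fin 3))) p)⁻¹ ^ 7 else 0) =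
        ∑ a ∈ (u.map (Function.Embedding.subtype _)).filter (· ≠ p), (dist a p)⁻¹ ^ (4 + 3) := by
      rw [Finset.sum_filter, Finset.sum_map]
      rfl
    rw [hsum]
    refine sum_inv_pow_le_of_separated _ p (by norm_num) (by norm_num) le_rfl ?_ ?_
    · intro a ha b hb hab
      simp only [Finset.mem_filter, Finset.mem_map, Function.Embedding.coe_subtype] at ha hb
      obtain ⟨⟨a', -, rfl⟩, -⟩ := ha
      obtain ⟨⟨b', -, rfl⟩, -⟩ := hb
      exact dist_sites_ge hA hI a'.2 b'.2 hab
    · intro a ha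
      simp only [Finset.mem_filter, Finset.mem_map, Function.Embedding.coe_subtype] at ha
      obtain ⟨⟨a', -, rfl⟩, ha2⟩ := ha
      exact dist_sites_ge hA hI a'.2 hp ha2
  exact ⟨summable_of_sum_le (fun q => by split_ifs <;> positivity) hbound,
    Real.tsum_le_of_sum_le (fun q => by split_ifs <;> positivity) hbound⟩

/-! ## The operator applied to an affine field -/

/-- On the sites, the difference of an affine field is `a m − a m' + B(p − q)`, of norm
`≤ ‖a 0 − a 1‖ + ‖B‖‖p − q‖`. [folklore] -/
theorem norm_affine_sub_le {aff : (EuclideanSpace ℝ (Fin 3)) → (EuclideanSpace ℝ (Fin 3))} {a : Fin 2 → EuclideanSpace ℝ (Fin 3)}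
    {B : (EuclideanSpace ℝ (Fin 3)) →L[ℝ] (EuclideanSpace ℝ (Fin 3))} {c₀ : EuclideanSpace ℝ (Fin 3)}
    (haff : ∀ (m : Fin 2) (z : EuclideanSpace ℝ (Fin 3)), z ∈ Λ₀ → aff (t m + A z) = a m + B (t m + A z - c₀))
    (p q : Sites₀ t A) :
    ‖aff p - aff q‖ ≤ ‖a 0 - a 1‖ + ‖B‖ * ‖(p : EuclideanSpace ℝ (Fin 3)) - q‖ := by
  obtain ⟨m, z, hz, hp⟩ := p.2
  obtain ⟨m', z', hz', hq⟩ := q.2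
  have h1 : aff p - aff q = (a m - a m') + B ((p : EuclideanSpace ℝ (Fin 3)) - q) := by
    rw [hp, hq, haff m z hz, haff m' z' hz']
    simp only [map_sub, map_add]
    abel
  rw [h1]
  refine (norm_add_le _ _).trans (add_le_add ?_ (B.le_opNorm _))
  fin_cases m <;> fin_cases m'
  · simp
  · simp
  · simp only [Fin.mk_one, Fin.zero_eta]; rw [norm_sub_rev]
  · simp

/-- The operator row of an affine field is absolutely summable: terms `≤ 38|p−q|⁻⁸(‖a 0 − a 1‖ + ‖B‖|p−q|)`.
[folklore] -/
theorem summable_affOpRow (hA : Adm₀ A) (hI : Inner₀ t A)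
    {aff : (EuclideanSpace ℝ (Fin 3)) → (EuclideanSpace ℝ (Fin 3))} {a : Fin 2 → EuclideanSpace ℝ (Fin 3)}
    {B : (EuclideanSpace ℝ (Fin 3)) →L[ℝ] (EuclideanSpace ℝ (Fin 3))} {c₀ : EuclideanSpace ℝ (Fin 3)}
    (haff : ∀ (m : Fin 2) (z : EuclideanSpace ℝ (Fin 3)), z ∈ Λ₀ → aff (t m + A z) = a m + B (t m + A z - c₀))
    (p : Sites₀ t A) :
    Summable (fun q : Sites₀ t A => (if (p : EuclideanSpace ℝ (Fin 3)) ≠ q then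
      𝕂[(p : EuclideanSpace ℝ (Fin 3)) - q] (aff p - aff q) else 0)) := by
  classical
  have h8 := summable_inv_pow_eight_sites hA hI p.2
  have h7 := (summable_inv_pow_seven_sites hA hI p.2).1
  refine Summable.of_norm_bounded ((h8.mul_left (38 * ‖a 0 - a 1‖)).add (h7.mul_left (38 * ‖B‖))) fun q => ?_
  by_cases hq : (p : (EuclideanSpace ℝ (Fin 3))) = q
  · simp [hq]
  · have hne : (q : (EuclideanSpace ℝ (Fin 3))) ≠ p := fun h => hq h.symm
    simp only [if_pos hq, if_pos hne]
    have hd : (23 / 25 : ℝ) ≤ dist (p : (EuclideanSpace ℝ (Fin 3))) q := dist_sites_ge hA hI p.2 q.2 hq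
    have he : 9 / 10 ≤ ‖(p : (EuclideanSpace ℝ (Fin 3))) - q‖ := by rw [← dist_eq_norm]; linarith
    have he0 : 0 < ‖(p : (EuclideanSpace ℝ (Fin 3))) - q‖ := by linarith
    refine (norm_forceConst_apply_le he _).trans ?_
    have hw := norm_affine_sub_le (t := t) (A := A) haff p q
    have hx : 0 ≤ (‖(p : (EuclideanSpace ℝ (Fin 3))) - q‖⁻¹) ^ 8 := by positivity
    have hdn : dist (q : (EuclideanSpace ℝ (Fin 3))) p = ‖(p : (EuclideanSpace ℝ (Fin 3))) - q‖ := by rw [dist_comm, dist_eq_norm]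
    rw [hdn]
    have hinv : (‖(p : (EuclideanSpace ℝ (Fin 3))) - q‖⁻¹) ^ 8 * ‖(p : (EuclideanSpace ℝ (Fin 3))) - q‖ =
        (‖(p : (EuclideanSpace ℝ (Fin 3))) - q‖⁻¹) ^ 7 := by
      field_simp
    calc 38 * (‖(p : (EuclideanSpace ℝ (Fin 3))) - q‖⁻¹) ^ 8 * ‖aff p - aff q‖
        ≤ 38 * (‖(p : (EuclideanSpace ℝ (Fin 3))) - q‖⁻¹) ^ 8 * (‖a 0 - a 1‖ + ‖B‖ * ‖(p : (EuclideanSpace ℝ (Fin 3))) - q‖) := by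
          gcongr
      _ = 38 * ‖a 0 - a 1‖ * (‖(p : (EuclideanSpace ℝ (Fin 3))) - q‖⁻¹) ^ 8 +
          38 * ‖B‖ * ((‖(p : (EuclideanSpace ℝ (Fin 3))) - q‖⁻¹) ^ 8 * ‖(p : (EuclideanSpace ℝ (Fin 3))) - q‖) := by ring
      _ = 38 * ‖a 0 - a 1‖ * (‖(p : (EuclideanSpace ℝ (Fin 3))) - q‖⁻¹) ^ 8 +
          38 * ‖B‖ * (‖(p : (EuclideanSpace ℝ (Fin 3))) - q‖⁻¹) ^ 7 := by rw [hinv]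

/-- **The operator applied to an affine field is a sublattice-wise constant field**: for every sublattice
`m` and all `z, z' ∈ Λ₀`, the operator rows of `aff` at the sites `t m + A z` and `t m + A z'` coincide.
[folklore] -/
theorem affOpRow_sublattice_const
    {aff : (EuclideanSpace ℝ (Fin 3)) → (EuclideanSpace ℝ (Fin 3))} {a : Fin 2 → EuclideanSpace ℝ (Fin 3)}
    {B : (EuclideanSpace ℝ (Fin 3)) →L[ℝ] (EuclideanSpace ℝ (Fin 3))} {c₀ : EuclideanSpace ℝ (Fin 3)}
    (haff : ∀ (m : Fin 2) (z : EuclideanSpace ℝ (Fin 3)), z ∈ Λ₀ → aff (t m + A z) = a m + B (t m + A z - c₀))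
    (m : Fin 2) {z z' : EuclideanSpace ℝ (Fin 3)} (hz : z ∈ Λ₀) (hz' : z' ∈ Λ₀) :
    (∑' q : Sites₀ t A, (if t m + A z' ≠ (q : EuclideanSpace ℝ (Fin 3)) then
        𝕂[t m + A z' - q] (aff (t m + A z') - aff q) else 0)) =
      ∑' q : Sites₀ t A, (if t m + A z ≠ (q : EuclideanSpace ℝ (Fin 3)) then
        𝕂[t m + A z - q] (aff (t m + A z) - aff q) else 0) := by
  refine tsum_pair_sublattice_const (t := t) (A := A)
    (fun p q => (if p ≠ q then 𝕂[p - q] (aff p - aff q) else 0)) ?_ m hz hz'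
  intro l hl p q
  have hpq : ((p : EuclideanSpace ℝ (Fin 3)) + A l ≠ (q : EuclideanSpace ℝ (Fin 3)) + A l) ↔
      ((p : EuclideanSpace ℝ (Fin 3)) ≠ q) := by
    rw [not_iff_not]; exact add_left_injective (A l) |>.eq_iff
  have hdiff : (p : EuclideanSpace ℝ (Fin 3)) + A l - ((q : EuclideanSpace ℝ (Fin 3)) + A l) =
      (p : EuclideanSpace ℝ (Fin 3)) - q := by abel
  have haffd : aff ((p : EuclideanSpace ℝ (Fin 3)) + A l) - aff ((q : EuclideanSpace ℝ (Fin 3)) + A l) = aff p - aff q := by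
    obtain ⟨mp, zp, hzp, hp⟩ := p.2
    obtain ⟨mq, zq, hzq, hq⟩ := q.2
    have hp' : (p : EuclideanSpace ℝ (Fin 3)) + A l = t mp + A (zp + l) := by rw [hp, map_add]; abel
    have hq' : (q : EuclideanSpace ℝ (Fin 3)) + A l = t mq + A (zq + l) := by rw [hq, map_add]; abel
    rw [hp', hq', haff mp _ (hcpLiouvilleLam_add_mem hzp hl), haff mq _ (hcpLiouvilleLam_add_mem hzq hl), hp, hq,
      haff mp zp hzp, haff mq zq hzq]
    simp only [map_add, map_sub]
    abel
  by_cases h : (p : EuclideanSpace ℝ (Fin 3)) = q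
  · simp only [ne_eq, h, not_true_eq_false, if_false]
  · rw [if_pos (hpq.2 h), if_pos h, hdiff, haffd]

end

end Summit.AtomisticToContinuum.Crystallization.Theorems.ExcessDecayLiouville

end
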